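import Summits.QuantumFields.BalabanUV.Beta.KernelWardRelativeEnd
import Summits.QuantumFields.BalabanUV.Beta.SymmetrisedDressingHessian

/-!
# `BalabanUV.Beta.KernelWardSymEnd` — the WARD-TRANSVERSALITY END (`hW`) over a RELATIVE inverse for the SYMMETRISED-DRESSED one-step family
# `fun j ↦ dressSymAt hr (Js⁰ j)` (β sub-cell, binder row D1, literal of record «JsB12Sym» (R-D1-g25-1); the `hW` twin of
# `SymmetrisedDressingHessian.axisReflectionCovariant_flipK_TbalOf_dressSymAt_compensated`, i.e. `KernelWardRelativeEnd` §3 with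
# `dressBmAt ↦ dressSymAt`, `coDressKBmAt ↦ coDressKSymAt`)

HONEST FRAMING (cell contract, verbatim): «discharging `BetaPertH` makes Bałaban's UV stability UNCONDITIONAL — a real
constructive-QFT result; it is NOT the continuum limit and NOT the Clay problem.»  THIS MODULE mints no `Prop` fact and no `def`, cites nothing
as a hypothesis, instantiates NO binder of the wall and DISCHARGES NOTHING of it: every jet law, inverse rule and Ward law below is a HYPOTHESIS
(socket) of the END, never a fact.  It TYPES the `hW` socket of the row's (0.4) root `RowD1JointEndSym.d1Drift_dressSymCtr_of_hW_compensated_D1Tel_D1Rep`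
(row-D1 owner an2-g26, CLAIMS 2026-08-21T04:05:01Z: «hW is a DIRECT binder until the sym hW END … is typed»), generic in the coarse projector `E` —
the symmetrised coordinate projector and its `RelInv` rules 1–2 are the owner's S-row objects and stay DISPLAYED binders here (as `h3`∕`h4` are in
an1's `KernelWardRelativeEnd.wardTransversal_flipK_TbalOf_JsBalBmNAtOf_ctrC`).  0∕4 binders of JsB12Sym; NOT D1, NOT `BetaPertH`, NOT continuum, NOT Clay.
HONEST DEPENDENCY (verbatim): continuum YM on T⁴ ⇐ BetaPertH ∧ nine spine estimates (0/9 proved); BetaPertH ⇐ (D1) ∧ (D4) ∧ CAP+tail;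
G-an2-4 gates asym, D1 and NE2/3/4.

ABSOLUTE RULE (cell charter, verbatim): «No internally-minted statement may enter as a cited fact. Every hypothesis is either kernel-proved in
this package or a verbatim quotation of a PUBLISHED theorem with page reference. The manuscript(s) under audit are NOT citable for their own
disputed steps — they are the thing under adjudication; programme-internal (2001/route/tribunal) claims are never citable.»

## What is here
* §1 `wardTransversal_flipK_TbalOf_dressSymAt_rel`: for UNDRESSED step jets `Js⁰ : ℕ → JetData 3 Lc` and an in-block root `r`, with
  `G_j := coDressKSymAt (toSite r) Lc (KInvStep Lc j)` (decay and block covariance are theorems: `decays_coDressKSymAt_KInvStep`,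
  `shiftK_coDressKSymAt_KInvStep`), the sockets of `KernelWardRelative` §2 per step `j` ⟹ `∀ j, WardTransversal (flipK (TbalOf Lc (fun j ↦ dressSymAt hr (Js⁰ j)) j))`
  (`TbalOf_dressSymAt` + `KernelWardRelative.wardTransversal_flipK_hessKer_conj_rel`).
* §2 `wardTransversal_flipK_TbalOf_dressSymCtr_rel`: the centred root `ctrOff 4 Lc` — the family `fun j ↦ dressSymAt (ctrOff_mem_box _) (Js⁰ j)` of
  `SymmetrisedDressingHessian.axisReflectionCovariant_flipK_TbalOf_dressSymCtr_compensated`; `E` still generic.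
* §3 THE PARITY FORM OF THE REMAINDER SOCKET (twin of `KernelWardRelativeEnd` §5): `sgnK_piKSymBm`, `trK_coDressKSymAt`,
  `trK_coDressKSymAt_KInvStep` (the symmetrised co-dressed step resolvents ARE sgn-symmetric — twins of `BubbleParity.sgnK_piKBm` ∕
  `trK_coDressKBmAt(_KInvStep)`), and `wardTransversal_flipK_TbalOf_dressSymAt_rel_parity` ∕ `…_dressSymCtr_rel_parity`: the scalar socket
  `hN0 : tadpole G_j (N …) = 0` replaced by the STRUCTURAL `hNt : trK (N …) = −sgnK (N …)` (`KernelWardRelativeEnd.tadpole_eq_zero_of_parity`).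
All declarations `[folklore]`; axioms standard.  Provenance: b2b-balaban β sub-cell, D1 formalisation swarm leaf seat
`b2b-balaban-beta-d1-formalise-leaf-04` gen 7, 2026-08-21 (v1); over `KernelWardRelative(End)` ∕ `BubbleParity` ∕ `SymmetrisedDressingKernel` ∕ `SymmetrisedDressingHessian` BY NAME; no existing file touched.
-/

open Finset
open scoped BigOperators
open Literature.MathematicalPhysics.QuantumFieldTheory
open Literature.MathematicalPhysics.QuantumFieldTheory.Balaban1983to89
open Literature.MathematicalPhysics.QuantumFieldTheory.Balaban1983to89.Beta
open B6BondElimination (unitVec unitVec_apply)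
open ExpKernelCalculus (MKer Decays BiLoc comp tr tadpole VertexFamily₂ shiftK)
open PolarizationSign (WardTransversal)
open KernelWard (divV divW)
open AffineAveraging (box toSite)
open AveragingContoursRooted (ctrOff ctrOff_mem_box)
open OneStepResolventKernel (Fib LocStencil JetData)
open OneStepKernelFamily (KInvStep colH vertexOfK TbalOf flipK)
open Summit.QuantumFields.BalabanUV.Beta.TameKernelCalculus
open Summit.QuantumFields.BalabanUV.Beta.ChartConjugation (conjV conjW)
open Summit.QuantumFields.BalabanUV.Beta.ChartConjugationRelative (RelInv)
open Summit.QuantumFields.BalabanUV.Beta.AxialDressingRooted (one_le_of_neZero)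
open Summit.QuantumFields.BalabanUV.Beta.BorderedHessian (sgnK comp_sgnK trK_sgnK sgnK_eq_self)
open Summit.QuantumFields.BalabanUV.Beta.BubbleParity (comp_sgnK_left_of_eq_self spr_of_decays trK_KInvStep spr_KInvStep)
open Summit.QuantumFields.BalabanUV.Beta.SymmetrisedDressingKernel (piKSymBm piKSymBm_inl_inr piKSymBm_inr_inl coDressKSymAt coDressKSymAt_eq
  spr_piKSymBm spr_trK_piKSymBm)
open Summit.QuantumFields.BalabanUV.Beta.SymmetrisedDressingDress (dressSymAt)
open Summit.QuantumFields.BalabanUV.Beta.SymmetrisedDressingHessian (TbalOf_dressSymAt decays_coDressKSymAt_KInvStep shiftK_coDressKSymAt_KInvStep)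
open Summit.QuantumFields.BalabanUV.Beta.KernelWardRelative (gaugeWt wardTransversal_flipK_hessKer_conj_rel)
open Summit.QuantumFields.BalabanUV.Beta.KernelWardRelativeEnd (tadpole_eq_zero_of_parity)

namespace Summit.QuantumFields.BalabanUV.Beta.KernelWardSymEnd

noncomputable section

/-! ## §1 The END for the symmetrised-dressed one-step family (dimension four), generic root and coarse projector -/

section Dressed

/-- [folklore] **THE `hW` BINDER FOR THE SYMMETRISED-DRESSED WALL FAMILY, OVER THE RELATIVE SOCKETS.**  Let `Js⁰ : ℕ → JetData 3 Lc` be UNDRESSED step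
jets and `r` an in-block root; the dressed family is `fun j ↦ dressSymAt hr (Js⁰ j)` (the shape of the row's (0.4) root).  Per step `j` put
`G_j := coDressKSymAt (toSite r) Lc (KInvStep Lc j)` (its decay and block covariance are theorems).  BINDERS: spread `𝕄 j` and `E` with
`RelInv G_j (𝕄 j) E`; the translation laws (St), (Wt) of the undressed jets; the ℋ-column Ward law of `G_j` (constant `c_H j`); generator families `X j y`
and contacts `X₂ j`, both localised and commuting with `E`, tadpole-null remainders `N j`; the block stencil Ward law with contact and the second-order
pure-gauge law of the UNDRESSED jets against `𝕄 j`.  CONCLUSION: `∀ j, WardTransversal (flipK (TbalOf Lc (fun j ↦ dressSymAt hr (Js⁰ j)) j))` — the `hW`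
hypothesis of `OneStepKernelFamily.d1Drift_of_D1Tel_D1Rep` ∕ `RowD1JointEndSym.d1Drift_dressSymCtr_of_hW_compensated_D1Tel_D1Rep` for the symmetrised-dressed
family.  Proof: `TbalOf_dressSymAt` + `KernelWardRelative.wardTransversal_flipK_hessKer_conj_rel`.  Discharges nothing by itself. -/
theorem wardTransversal_flipK_TbalOf_dressSymAt_rel {Lc : ℕ} [NeZero Lc] {r : Fin 4 → ℕ} (hr : r ∈ box 4 Lc) (Js : ℕ → JetData 3 Lc)
    (M : ℕ → MKer 4 (Fib 3)) (E : MKer 4 (Fib 3)) (hM : ∀ j, Spr (M j)) (hE : Spr E)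
    (hR : ∀ j, RelInv (coDressKSymAt (toSite r) Lc (KInvStep (d := 3) Lc j)) (M j) E)
    (hSt : ∀ (j : ℕ) (κ' : Fin 4) (u t : Fin 4 → ℤ), (Js j).S κ' (u + (Lc : ℤ) • t) = shiftK (-((Lc : ℤ) • t)) ((Js j).S κ' u))
    (hWt : ∀ (j : ℕ) (μ : Fin 4) (y : Fin 4 → ℤ) (ν : Fin 4) (y' t : Fin 4 → ℤ),
      (Js j).W μ (y + t) ν (y' + t) = shiftK (-((Lc : ℤ) • t)) ((Js j).W μ y ν y'))
    (cH : ℕ → ℝ) (hH : ∀ (j : ℕ) (y : Fin 4 → ℤ) (κ' : Fin 4) (u : Fin 4 → ℤ),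
      ∑ μ, (colH (coDressKSymAt (toSite r) Lc (KInvStep (d := 3) Lc j)) Lc μ (y - unitVec μ) κ' u
        - colH (coDressKSymAt (toSite r) Lc (KInvStep (d := 3) Lc j)) Lc μ y κ' u) = cH j * gaugeWt Lc y κ' u)
    (X : ℕ → (Fin 4 → ℤ) → MKer 4 (Fib 3)) (hX : ∀ j y, Loc (X j y)) (hEX : ∀ j y, comp E (X j y) = comp (X j y) E)
    (X₂ Nr : ℕ → (Fin 4 → ℤ) → Fin 4 → (Fin 4 → ℤ) → MKer 4 (Fib 3)) (hX₂ : ∀ j y ν y', Loc (X₂ j y ν y'))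
    (hNr : ∀ j y ν y', Loc (Nr j y ν y')) (hEX₂ : ∀ j y ν y', comp E (X₂ j y ν y') = comp (X₂ j y ν y') E)
    (hSd : ∀ (j : ℕ) (y : Fin 4 → ℤ), cH j • ∑ v ∈ box 4 Lc, divV (Js j).S ((Lc : ℤ) • y + toSite v) = conjV (M j) (X j y))
    (hWd : ∀ (j : ℕ) (y : Fin 4 → ℤ) (ν : Fin 4) (y' : Fin 4 → ℤ),
      divW (Js j).W y ν y' = conjW (M j) 0 (vertexOfK (coDressKSymAt (toSite r) Lc (KInvStep (d := 3) Lc j)) Lc (Js j).S ν y') (X j y) 0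
        (X₂ j y ν y') + Nr j y ν y')
    (hN0 : ∀ j y ν y', tadpole (coDressKSymAt (toSite r) Lc (KInvStep (d := 3) Lc j)) (Nr j y ν y') = 0) :
    ∀ j : ℕ, WardTransversal (flipK (TbalOf Lc (fun j => dressSymAt hr (Js j)) j)) := by
  intro j
  rw [TbalOf_dressSymAt hr Js j]
  exact wardTransversal_flipK_hessKer_conj_rel (d := 3) (N := Lc) (decays_coDressKSymAt_KInvStep (d := 3) hr j)
    (shiftK_coDressKSymAt_KInvStep (d := 3) (toSite r) j)
    (one_le_of_neZero Lc) (hM j) hE (hR j) (Js j) (hSt j) (hWt j) (cH j) (hH j) (X j) (hX j) (hEX j) (X₂ j) (Nr j) (hX₂ j) (hNr j)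
    (hEX₂ j) (hSd j) (hWd j) (hN0 j)

end Dressed

/-! ## §2 The centred root -/

section Centred

/-- [folklore] **`hW` FOR THE CENTRED SYMMETRISED-DRESSED FAMILY** `fun j ↦ dressSymAt (ctrOff_mem_box _) (Js⁰ j)` (the family of
`SymmetrisedDressingHessian.axisReflectionCovariant_flipK_TbalOf_dressSymCtr_compensated` and of the row's (0.4) root): §1 at the root
`ctrOff 4 Lc`; the coarse projector `E` and its `RelInv` rules stay DISPLAYED binders (the symmetrised coordinate projector is not wired here).
CONCLUSION: `∀ j, WardTransversal (flipK (TbalOf Lc (fun j ↦ dressSymAt (ctrOff_mem_box (one_le_of_neZero Lc)) (Js⁰ j)) j))`.  Discharges nothing by itself. -/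
theorem wardTransversal_flipK_TbalOf_dressSymCtr_rel {Lc : ℕ} [NeZero Lc] (Js : ℕ → JetData 3 Lc)
    (M : ℕ → MKer 4 (Fib 3)) (E : MKer 4 (Fib 3)) (hM : ∀ j, Spr (M j)) (hE : Spr E)
    (hR : ∀ j, RelInv (coDressKSymAt (toSite (ctrOff 4 Lc)) Lc (KInvStep (d := 3) Lc j)) (M j) E)
    (hSt : ∀ (j : ℕ) (κ' : Fin 4) (u t : Fin 4 → ℤ), (Js j).S κ' (u + (Lc : ℤ) • t) = shiftK (-((Lc : ℤ) • t)) ((Js j).S κ' u))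
    (hWt : ∀ (j : ℕ) (μ : Fin 4) (y : Fin 4 → ℤ) (ν : Fin 4) (y' t : Fin 4 → ℤ),
      (Js j).W μ (y + t) ν (y' + t) = shiftK (-((Lc : ℤ) • t)) ((Js j).W μ y ν y'))
    (cH : ℕ → ℝ) (hH : ∀ (j : ℕ) (y : Fin 4 → ℤ) (κ' : Fin 4) (u : Fin 4 → ℤ),
      ∑ μ, (colH (coDressKSymAt (toSite (ctrOff 4 Lc)) Lc (KInvStep (d := 3) Lc j)) Lc μ (y - unitVec μ) κ' u
        - colH (coDressKSymAt (toSite (ctrOff 4 Lc)) Lc (KInvStep (d := 3) Lc j)) Lc μ y κ' u) = cH j * gaugeWt Lc y κ' u)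
    (X : ℕ → (Fin 4 → ℤ) → MKer 4 (Fib 3)) (hX : ∀ j y, Loc (X j y)) (hEX : ∀ j y, comp E (X j y) = comp (X j y) E)
    (X₂ Nr : ℕ → (Fin 4 → ℤ) → Fin 4 → (Fin 4 → ℤ) → MKer 4 (Fib 3)) (hX₂ : ∀ j y ν y', Loc (X₂ j y ν y'))
    (hNr : ∀ j y ν y', Loc (Nr j y ν y')) (hEX₂ : ∀ j y ν y', comp E (X₂ j y ν y') = comp (X₂ j y ν y') E)
    (hSd : ∀ (j : ℕ) (y : Fin 4 → ℤ), cH j • ∑ v ∈ box 4 Lc, divV (Js j).S ((Lc : ℤ) • y + toSite v) = conjV (M j) (X j y))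
    (hWd : ∀ (j : ℕ) (y : Fin 4 → ℤ) (ν : Fin 4) (y' : Fin 4 → ℤ),
      divW (Js j).W y ν y' = conjW (M j) 0 (vertexOfK (coDressKSymAt (toSite (ctrOff 4 Lc)) Lc (KInvStep (d := 3) Lc j)) Lc (Js j).S ν y')
        (X j y) 0 (X₂ j y ν y') + Nr j y ν y')
    (hN0 : ∀ j y ν y', tadpole (coDressKSymAt (toSite (ctrOff 4 Lc)) Lc (KInvStep (d := 3) Lc j)) (Nr j y ν y') = 0) :
    ∀ j : ℕ, WardTransversal
      (flipK (TbalOf Lc (fun j => dressSymAt (ctrOff_mem_box (d := 4) (one_le_of_neZero Lc)) (Js j)) j)) :=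
  wardTransversal_flipK_TbalOf_dressSymAt_rel (ctrOff_mem_box (d := 4) (one_le_of_neZero Lc)) Js M E hM hE hR hSt hWt cH hH X hX hEX
    X₂ Nr hX₂ hNr hEX₂ hSd hWd hN0

end Centred

/-! ## §3 The parity form of the remainder socket for the symmetrised dressing -/

section Parity

variable {d : ℕ}

/-- [folklore] The symmetrised block-mean dressing projector has no mixed blocks, hence is fixed by `sgnK` (twin of `BubbleParity.sgnK_piKBm`). -/
theorem sgnK_piKSymBm (ρ : Fin (d + 1) → ℤ) (N : ℕ) : sgnK (piKSymBm (d := d) ρ N) = piKSymBm ρ N :=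
  sgnK_eq_self (fun x y κ l => piKSymBm_inl_inr ρ N x y κ l) (fun x y κ l => piKSymBm_inr_inl ρ N x y κ l)

/-- [folklore] **Symmetrised co-dressing preserves sgn-symmetry** (twin of `BubbleParity.trK_coDressKBmAt`): for a spread sgn-symmetric `K` and an
in-block root, `trK (Π̂_symᵀ K Π̂_sym) = sgnK (Π̂_symᵀ K Π̂_sym)`. -/
theorem trK_coDressKSymAt {N : ℕ} (hN : 1 ≤ N) {r : Fin (d + 1) → ℕ} (hr : r ∈ box (d + 1) N) {K : MKer (d + 1) (Fib d)}
    (hK : Spr K) (hKt : trK K = sgnK K) :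
    trK (coDressKSymAt (toSite r) N K) = sgnK (coDressKSymAt (toSite r) N K) := by
  have hT : sgnK (trK (piKSymBm (d := d) (toSite r) N)) = trK (piKSymBm (toSite r) N) := by
    rw [← trK_sgnK, sgnK_piKSymBm]
  rw [coDressKSymAt_eq, trK_comp, trK_comp, trK_trK, hKt, comp_sgnK_left_of_eq_self (sgnK_piKSymBm _ _)]
  have h : comp (trK (piKSymBm (d := d) (toSite r) N)) (sgnK (comp K (piKSymBm (toSite r) N))) =
      comp (sgnK (trK (piKSymBm (d := d) (toSite r) N))) (sgnK (comp K (piKSymBm (toSite r) N))) := by rw [hT]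
  rw [h, comp_sgnK, comp_assoc_tame (spr_trK_piKSymBm hN hr).tame hK.tame (spr_piKSymBm hN hr).tame]

/-- [folklore] **The symmetrised co-dressed step resolvents are sgn-symmetric** (every `j`, every in-block root; twin of
`BubbleParity.trK_coDressKBmAt_KInvStep`). -/
theorem trK_coDressKSymAt_KInvStep {Lc : ℕ} [NeZero Lc] {r : Fin (d + 1) → ℕ} (hr : r ∈ box (d + 1) Lc) (j : ℕ) :
    trK (coDressKSymAt (toSite r) Lc (KInvStep (d := d) Lc j)) = sgnK (coDressKSymAt (toSite r) Lc (KInvStep (d := d) Lc j)) :=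
  trK_coDressKSymAt (one_le_of_neZero Lc) hr (spr_KInvStep Lc j) (trK_KInvStep Lc j)

/-- [folklore] **THE `hW` END FOR THE SYMMETRISED-DRESSED FAMILY, PARITY FORM OF THE REMAINDER** (twin of
`KernelWardRelativeEnd.wardTransversal_flipK_TbalOf_JsBalBmNAtOf_ctrC_parity` at the generic root ∕ projector): as §1, with the scalar remainder
socket `hN0 : tadpole G_j (N j y ν y′) = 0` replaced by the STRUCTURAL one `hNt : trK (N j y ν y′) = −sgnK (N j y ν y′)` — discharged inside by
`tadpole_eq_zero_of_parity`, the symmetrised co-dressed step resolvents being sgn-symmetric (`trK_coDressKSymAt_KInvStep`) and spread. -/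
theorem wardTransversal_flipK_TbalOf_dressSymAt_rel_parity {Lc : ℕ} [NeZero Lc] {r : Fin 4 → ℕ} (hr : r ∈ box 4 Lc) (Js : ℕ → JetData 3 Lc)
    (M : ℕ → MKer 4 (Fib 3)) (E : MKer 4 (Fib 3)) (hM : ∀ j, Spr (M j)) (hE : Spr E)
    (hR : ∀ j, RelInv (coDressKSymAt (toSite r) Lc (KInvStep (d := 3) Lc j)) (M j) E)
    (hSt : ∀ (j : ℕ) (κ' : Fin 4) (u t : Fin 4 → ℤ), (Js j).S κ' (u + (Lc : ℤ) • t) = shiftK (-((Lc : ℤ) • t)) ((Js j).S κ' u))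
    (hWt : ∀ (j : ℕ) (μ : Fin 4) (y : Fin 4 → ℤ) (ν : Fin 4) (y' t : Fin 4 → ℤ),
      (Js j).W μ (y + t) ν (y' + t) = shiftK (-((Lc : ℤ) • t)) ((Js j).W μ y ν y'))
    (cH : ℕ → ℝ) (hH : ∀ (j : ℕ) (y : Fin 4 → ℤ) (κ' : Fin 4) (u : Fin 4 → ℤ),
      ∑ μ, (colH (coDressKSymAt (toSite r) Lc (KInvStep (d := 3) Lc j)) Lc μ (y - unitVec μ) κ' u
        - colH (coDressKSymAt (toSite r) Lc (KInvStep (d := 3) Lc j)) Lc μ y κ' u) = cH j * gaugeWt Lc y κ' u)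
    (X : ℕ → (Fin 4 → ℤ) → MKer 4 (Fib 3)) (hX : ∀ j y, Loc (X j y)) (hEX : ∀ j y, comp E (X j y) = comp (X j y) E)
    (X₂ Nr : ℕ → (Fin 4 → ℤ) → Fin 4 → (Fin 4 → ℤ) → MKer 4 (Fib 3)) (hX₂ : ∀ j y ν y', Loc (X₂ j y ν y'))
    (hNr : ∀ j y ν y', Loc (Nr j y ν y')) (hEX₂ : ∀ j y ν y', comp E (X₂ j y ν y') = comp (X₂ j y ν y') E)
    (hSd : ∀ (j : ℕ) (y : Fin 4 → ℤ), cH j • ∑ v ∈ box 4 Lc, divV (Js j).S ((Lc : ℤ) • y + toSite v) = conjV (M j) (X j y))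
    (hWd : ∀ (j : ℕ) (y : Fin 4 → ℤ) (ν : Fin 4) (y' : Fin 4 → ℤ),
      divW (Js j).W y ν y' = conjW (M j) 0 (vertexOfK (coDressKSymAt (toSite r) Lc (KInvStep (d := 3) Lc j)) Lc (Js j).S ν y') (X j y) 0
        (X₂ j y ν y') + Nr j y ν y')
    (hNt : ∀ j y ν y', trK (Nr j y ν y') = -sgnK (Nr j y ν y')) :
    ∀ j : ℕ, WardTransversal (flipK (TbalOf Lc (fun j => dressSymAt hr (Js j)) j)) :=
  wardTransversal_flipK_TbalOf_dressSymAt_rel hr Js M E hM hE hR hSt hWt cH hH X hX hEX X₂ Nr hX₂ hNr hEX₂ hSd hWd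
    fun j y ν y' => tadpole_eq_zero_of_parity (spr_of_decays (decays_coDressKSymAt_KInvStep (d := 3) hr j))
      (trK_coDressKSymAt_KInvStep (d := 3) hr j) (hNr j y ν y') (hNt j y ν y')

/-- [folklore] **… AT THE CENTRED ROOT** (the family of the row's (0.4) root), parity form of the remainder socket. -/
theorem wardTransversal_flipK_TbalOf_dressSymCtr_rel_parity {Lc : ℕ} [NeZero Lc] (Js : ℕ → JetData 3 Lc)
    (M : ℕ → MKer 4 (Fib 3)) (E : MKer 4 (Fib 3)) (hM : ∀ j, Spr (M j)) (hE : Spr E)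
    (hR : ∀ j, RelInv (coDressKSymAt (toSite (ctrOff 4 Lc)) Lc (KInvStep (d := 3) Lc j)) (M j) E)
    (hSt : ∀ (j : ℕ) (κ' : Fin 4) (u t : Fin 4 → ℤ), (Js j).S κ' (u + (Lc : ℤ) • t) = shiftK (-((Lc : ℤ) • t)) ((Js j).S κ' u))
    (hWt : ∀ (j : ℕ) (μ : Fin 4) (y : Fin 4 → ℤ) (ν : Fin 4) (y' t : Fin 4 → ℤ),
      (Js j).W μ (y + t) ν (y' + t) = shiftK (-((Lc : ℤ) • t)) ((Js j).W μ y ν y'))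
    (cH : ℕ → ℝ) (hH : ∀ (j : ℕ) (y : Fin 4 → ℤ) (κ' : Fin 4) (u : Fin 4 → ℤ),
      ∑ μ, (colH (coDressKSymAt (toSite (ctrOff 4 Lc)) Lc (KInvStep (d := 3) Lc j)) Lc μ (y - unitVec μ) κ' u
        - colH (coDressKSymAt (toSite (ctrOff 4 Lc)) Lc (KInvStep (d := 3) Lc j)) Lc μ y κ' u) = cH j * gaugeWt Lc y κ' u)
    (X : ℕ → (Fin 4 → ℤ) → MKer 4 (Fib 3)) (hX : ∀ j y, Loc (X j y)) (hEX : ∀ j y, comp E (X j y) = comp (X j y) E)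
    (X₂ Nr : ℕ → (Fin 4 → ℤ) → Fin 4 → (Fin 4 → ℤ) → MKer 4 (Fib 3)) (hX₂ : ∀ j y ν y', Loc (X₂ j y ν y'))
    (hNr : ∀ j y ν y', Loc (Nr j y ν y')) (hEX₂ : ∀ j y ν y', comp E (X₂ j y ν y') = comp (X₂ j y ν y') E)
    (hSd : ∀ (j : ℕ) (y : Fin 4 → ℤ), cH j • ∑ v ∈ box 4 Lc, divV (Js j).S ((Lc : ℤ) • y + toSite v) = conjV (M j) (X j y))
    (hWd : ∀ (j : ℕ) (y : Fin 4 → ℤ) (ν : Fin 4) (y' : Fin 4 → ℤ),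
      divW (Js j).W y ν y' = conjW (M j) 0 (vertexOfK (coDressKSymAt (toSite (ctrOff 4 Lc)) Lc (KInvStep (d := 3) Lc j)) Lc (Js j).S ν y')
        (X j y) 0 (X₂ j y ν y') + Nr j y ν y')
    (hNt : ∀ j y ν y', trK (Nr j y ν y') = -sgnK (Nr j y ν y')) :
    ∀ j : ℕ, WardTransversal
      (flipK (TbalOf Lc (fun j => dressSymAt (ctrOff_mem_box (d := 4) (one_le_of_neZero Lc)) (Js j)) j)) :=
  wardTransversal_flipK_TbalOf_dressSymAt_rel_parity (ctrOff_mem_box (d := 4) (one_le_of_neZero Lc)) Js M E hM hE hR hSt hWt cH hH X hX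
    hEX X₂ Nr hX₂ hNr hEX₂ hSd hWd hNt

end Parity

end

end Summit.QuantumFields.BalabanUV.Beta.KernelWardSymEnd
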